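import Literature.NumberTheory.Sieve.SmoothNumbersRestrictedPrimesLowerBound
import Literature.NumberTheory.Sieve.SmoothNumbersLHalfAnalytic
import Literature.NumberTheory.LFunctions.MertensTail
import Mathlib.NumberTheory.Chebyshev
import Mathlib.Analysis.Complex.ExponentialBounds
import Mathlib.Analysis.SpecialFunctions.Pow.Real
import Mathlib.Analysis.SpecialFunctions.Sqrt
import Mathlib.Analysis.SpecialFunctions.Exponential
import HarnessLib

/-!
# Smooth numbers in the `L[1/2]` range: `ψ(x, L_x[1/2, β]) ≥ x · L_x[1/2, -1/(2β) - o(1)]`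

The lower bound for smooth numbers that every `L[1/2]` running-time analysis consumes
(Canfield–Erdős–Pomerance 1983; in the form of Lenstra–Pomerance, *A rigorous time bound for
factoring integers*, J. Amer. Math. Soc. **5** (1992), Theorem 6.1, specialised to the set of all
primes): for `β > 0`, `ε > 0`, all large `x` and all `y ≥ exp (β √(log x log log x))`,

  `ψ(x, y) ≥ x · exp (-(1/(2β) + ε) √(log x · log log x))`      (`card_factoredUpTo_primesLE_ge_LHalf`),

where `ψ(x, y) = #(factoredUpTo (Nat.primesLE y) x)` is the number of `1 ≤ n ≤ x` without prime
factors `> y`. With `u = log x / log y` this is `ψ(x, y) ≥ x u^{-u(1 + o(1))}`.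

Route (the paper's §6): the combinatorial Theorem 6.1 `card_factoredUpTo_ge` with `Q =` primes
`≤ y`, `T =` primes in `(V, y]`, `R =` primes `≤ W`, turned into the explicit exponential bound
`card_factoredUpTo_primesLE_ge_exp` (Chebyshev's `π(w) ≥ w / (4 log w)` from Mathlib's
`Chebyshev.pi_ge`, and `n! ≤ n^n`); then `k = ⌊u⌋`, `V = y^{1 - 1/log u}`, `W = y^{(log u)^{-1/2}}`,
`J = ⌈2 (u/log u + 1) √(log u)⌉`, `S₀ = 1/(2 log u)` (Mertens over the window `(V, y]`,
`MertensBound.loglog_sub_loglog_le_sum_inv_prime`) and `LHalf.eventually_bookkeeping`.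
Everything is proved; no named facts.

## References

* H. W. Lenstra Jr., C. Pomerance, *A rigorous time bound for factoring integers*, J. Amer. Math.
  Soc. 5 (1992) 483–516, §6, Theorem 6.1. [LenstraPomerance1992]
* E. R. Canfield, P. Erdős, C. Pomerance, J. Number Theory 17 (1983) 1–28 (CEP lower bound).
-/

namespace Literature.NumberTheory.Sieve

open Finset Filter

/-! ### A Chebyshev-type lower bound `π(w) ≥ w / (4 log w)` -/

/-- For `w ≥ 4`, `π(w) ≥ w / (4 log w)` (from Mathlib's `Chebyshev.pi_ge`:
`π(w) ≥ (w log 2 - log (w + 1)) / log w`, and `log (w+1) ≤ (w+1)/8 - 1 + 3 log 2`). [folklore] -/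
theorem div_four_mul_log_le_primeCounting {w : ℕ} (hw : 4 ≤ w) :
    (w : ℝ) / (4 * Real.log w) ≤ Nat.primeCounting w := by
  have hw' : (4 : ℝ) ≤ w := by exact_mod_cast hw
  have hlogw : 0 < Real.log w := Real.log_pos (by linarith)
  have h2 := Real.log_two_gt_d9
  have h2' := Real.log_two_lt_d9
  -- `log (w + 1) ≤ (w + 1) / 8 - 1 + log 8`
  have hlog : Real.log ((w : ℝ) + 1) ≤ ((w : ℝ) + 1) / 8 - 1 + 3 * Real.log 2 := by
    have h8 : Real.log ((w : ℝ) + 1) = Real.log (((w : ℝ) + 1) / 8) + Real.log 8 := by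
      rw [← Real.log_mul (by positivity) (by norm_num), div_mul_cancel₀ _ (by norm_num)]
    have h8' : Real.log (8 : ℝ) = 3 * Real.log 2 := by
      rw [show (8 : ℝ) = 2 ^ 3 by norm_num, Real.log_pow]; norm_num
    rw [h8, h8']
    linarith [Real.log_le_sub_one_of_pos (show (0 : ℝ) < ((w : ℝ) + 1) / 8 by positivity)]
  have hmain : (w : ℝ) / 4 ≤ (w * Real.log 2 - Real.log (w + 1)) := by nlinarith
  calc (w : ℝ) / (4 * Real.log w) = ((w : ℝ) / 4) / Real.log w := by rw [div_div]
    _ ≤ (w * Real.log 2 - Real.log (w + 1)) / Real.log w :=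
        div_le_div_of_nonneg_right hmain hlogw.le
    _ ≤ Nat.primeCounting w := Chebyshev.pi_ge w

/-! ### From the combinatorial bound to an exponential bound -/

/-- `n! ≤ n ^ n` in exponential form: `(n! : ℝ) ≤ exp (n log n)` (with `0 · log 0 = 0`). [folklore] -/
theorem factorial_le_exp_mul_log (n : ℕ) : (n.factorial : ℝ) ≤ Real.exp (n * Real.log n) := by
  rcases Nat.eq_zero_or_pos n with rfl | hn
  · simp
  · have h : (n.factorial : ℝ) ≤ (n : ℝ) ^ n := by exact_mod_cast Nat.factorial_le_pow n
    refine h.trans (le_of_eq ?_)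
    rw [← Real.rpow_natCast, Real.rpow_def_of_pos (by exact_mod_cast hn), mul_comm]

/-- `k log k ≤ u log u` for naturals `k ≤ u`, `u ≥ 1` real. [folklore] -/
theorem natCast_mul_log_le {k : ℕ} {u : ℝ} (hku : (k : ℝ) ≤ u) (hu : 1 ≤ u) :
    (k : ℝ) * Real.log k ≤ u * Real.log u := by
  rcases Nat.eq_zero_or_pos k with rfl | hk
  · simp only [Nat.cast_zero, zero_mul]
    exact mul_nonneg (by linarith) (Real.log_nonneg hu)
  · have hk1 : (1 : ℝ) ≤ k := by exact_mod_cast hk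
    exact mul_le_mul hku (Real.log_le_log (by linarith) hku) (Real.log_nonneg hk1) (by linarith)

/-- **Smooth numbers in an `L[1/2]`-type window, explicit form.** For a natural number `x`, reals
`16 ≤ W ≤ V ≤ Y`, naturals `k, J` and reals `u ≥ 1`, `0 < S₀ ≤ 1` with
`Y ^ k ≤ x < V ^ k · (W/2) ^ (J+1)`, `k ≤ u`, `S₀ ≤ ∑_{V < p ≤ Y} 1/p`:
`ψ(x, Y) ≥ x · exp (-(u log (1/S₀) + u log u + J log (4 log W) + J log J + log W))`.
This is `card_factoredUpTo_ge` ([LP92, Thm 6.1] in combinatorial form) for `Q =` primes `≤ Y`,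
`T =` primes in `(V, Y]`, `R =` primes `≤ W`, combined with `π(w) ≥ w/(4 log w)` and `n! ≤ n^n`.
[cite: LenstraPomerance1992, §6 Thm 6.1 (6.11)] -/
theorem card_factoredUpTo_primesLE_ge_exp {x k J : ℕ} {Y V W u S₀ : ℝ}
    (hW : 16 ≤ W) (hWV : W ≤ V) (hVY : V ≤ Y) (hYk : Y ^ k ≤ x)
    (hJ : (x : ℝ) < V ^ k * (W / 2) ^ (J + 1)) (hu : 1 ≤ u) (hku : (k : ℝ) ≤ u) (hS₀ : 0 < S₀)
    (hS₀1 : S₀ ≤ 1)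
    (hS : S₀ ≤ ∑ p ∈ (Ioc ⌊V⌋₊ ⌊Y⌋₊).filter Nat.Prime, (p : ℝ)⁻¹) :
    (x : ℝ) * Real.exp (-(u * Real.log S₀⁻¹ + u * Real.log u + J * Real.log (4 * Real.log W) +
        J * Real.log J + Real.log W)) ≤ #(factoredUpTo (Nat.primesLE ⌊Y⌋₊) x) := by
  -- the integer parameters
  set w : ℕ := ⌊W⌋₊ with hw_def
  set yN : ℕ := ⌊Y⌋₊ with hyN_def
  set T : Finset ℕ := (Ioc ⌊V⌋₊ yN).filter Nat.Prime with hT_def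
  have hW0 : (0 : ℝ) ≤ W := by linarith
  have hV0 : (0 : ℝ) ≤ V := by linarith
  have hY0 : (0 : ℝ) ≤ Y := by linarith
  have hw16 : 16 ≤ w := Nat.le_floor (by exact_mod_cast hW)
  have hwW : (w : ℝ) ≤ W := Nat.floor_le hW0
  have hWw : W / 2 ≤ w := by
    have := Nat.lt_floor_add_one W
    rw [← hw_def] at this
    linarith
  have hw0 : (0 : ℝ) < w := by exact_mod_cast (show 0 < w by omega)
  have hwV : w ≤ ⌊V⌋₊ := Nat.floor_mono hWV
  have hwY : w ≤ yN := Nat.floor_mono (hWV.trans hVY)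
  -- hypotheses of the combinatorial theorem
  have hR : ∀ p ∈ Nat.primesLE w, p.Prime := fun p hp => Nat.prime_of_mem_primesLE hp
  have hT : ∀ p ∈ T, p.Prime := fun p hp => (mem_filter.1 hp).2
  have hRQ : Nat.primesLE w ⊆ Nat.primesLE yN := fun p hp =>
    Nat.mem_primesLE.2 ⟨(Nat.le_of_mem_primesLE hp).trans hwY, Nat.prime_of_mem_primesLE hp⟩
  have hTQ : T ⊆ Nat.primesLE yN := fun p hp =>
    Nat.mem_primesLE.2 ⟨(mem_Ioc.1 (mem_filter.1 hp).1).2, (mem_filter.1 hp).2⟩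
  have hRT : Disjoint (Nat.primesLE w) T := by
    rw [disjoint_left]
    intro p hp hpT
    have h1 := Nat.le_of_mem_primesLE hp
    have h2 := (mem_Ioc.1 (mem_filter.1 hpT).1).1
    omega
  have hRw : ∀ p ∈ Nat.primesLE w, p ≤ w := fun p hp => Nat.le_of_mem_primesLE hp
  have hTv : ∀ p ∈ T, ⌊V⌋₊ + 1 ≤ p := fun p hp => (mem_Ioc.1 (mem_filter.1 hp).1).1
  have hTy : ∀ p ∈ T, p ≤ yN := fun p hp => (mem_Ioc.1 (mem_filter.1 hp).1).2
  have hx : yN ^ k ≤ x := by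
    have h1 : ((yN : ℕ) : ℝ) ^ k ≤ Y ^ k := pow_le_pow_left₀ (Nat.cast_nonneg _) (Nat.floor_le hY0) k
    exact_mod_cast h1.trans hYk
  have hJ' : x < (⌊V⌋₊ + 1) ^ k * w ^ (J + 1) := by
    have h1 : V ^ k ≤ ((⌊V⌋₊ + 1 : ℕ) : ℝ) ^ k :=
      pow_le_pow_left₀ hV0 (by push_cast; exact (Nat.lt_floor_add_one V).le) k
    have h2 : (W / 2) ^ (J + 1) ≤ (w : ℝ) ^ (J + 1) := pow_le_pow_left₀ (by linarith) hWw (J + 1)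
    have h3 : (x : ℝ) < ((⌊V⌋₊ + 1 : ℕ) : ℝ) ^ k * (w : ℝ) ^ (J + 1) :=
      hJ.trans_le (mul_le_mul h1 h2 (by positivity) (by positivity))
    exact_mod_cast h3
  have hmain := card_factoredUpTo_ge hR hT hRQ hTQ hRT (by omega) hRw (Nat.succ_pos _) hTv hTy
    hx hJ'
  -- `q / w ≥ 1 / (4 log W)`
  have hlogw : 0 < Real.log w := Real.log_pos (by exact_mod_cast (show 1 < w by omega))
  have hlogW : Real.log w ≤ Real.log W := Real.log_le_log hw0 hwW
  have hq : (4 * Real.log W)⁻¹ ≤ (#(Nat.primesLE w) : ℝ) / w := by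
    rw [Nat.primesLE_card_eq_primeCounting]
    have h1 := div_four_mul_log_le_primeCounting (show 4 ≤ w by omega)
    rw [le_div_iff₀ hw0]
    calc (4 * Real.log W)⁻¹ * w = w / (4 * Real.log W) := by rw [inv_mul_eq_div]
      _ ≤ w / (4 * Real.log w) := by
          exact div_le_div_of_nonneg_left hw0.le (by positivity) (by linarith)
      _ ≤ Nat.primeCounting w := h1
  have hlW1 : 1 ≤ 4 * Real.log W := by
    have : Real.log 16 ≤ Real.log W := Real.log_le_log (by norm_num) hW
    have h16 : (1 : ℝ) ≤ Real.log 16 := by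
      rw [show (16 : ℝ) = 2 ^ 4 by norm_num, Real.log_pow]
      push_cast
      linarith [Real.log_two_gt_d9]
    linarith
  -- each factor in exponential form
  set S : ℝ := ∑ p ∈ T, (p : ℝ)⁻¹ with hS_def
  have hE1 : Real.exp (-(u * Real.log S₀⁻¹)) ≤ S ^ k := by
    have h1 : S₀ ^ k ≤ S ^ k := pow_le_pow_left₀ hS₀.le hS k
    refine le_trans ?_ h1
    rw [← Real.rpow_natCast, Real.rpow_def_of_pos hS₀, Real.log_inv]
    exact Real.exp_le_exp.2 (by nlinarith [Real.log_nonpos hS₀.le hS₀1])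
  have hE2 : Real.exp (-(J * Real.log (4 * Real.log W))) ≤ ((#(Nat.primesLE w) : ℝ) / w) ^ J := by
    have h1 : ((4 * Real.log W)⁻¹) ^ J ≤ ((#(Nat.primesLE w) : ℝ) / w) ^ J :=
      pow_le_pow_left₀ (by positivity) hq J
    refine le_trans (le_of_eq ?_) h1
    rw [← Real.rpow_natCast, Real.rpow_def_of_pos (by positivity), Real.log_inv]
    ring_nf
  have hE3 : Real.exp (-(J * Real.log J)) ≤ ((J.factorial : ℝ))⁻¹ := by
    rw [Real.exp_neg]
    exact inv_anti₀ (by positivity) (factorial_le_exp_mul_log J)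
  have hE4 : Real.exp (-(u * Real.log u)) ≤ ((k.factorial : ℝ))⁻¹ := by
    rw [Real.exp_neg]
    refine inv_anti₀ (by positivity) ((factorial_le_exp_mul_log k).trans ?_)
    exact Real.exp_le_exp.2 (natCast_mul_log_le hku hu)
  have hE5 : Real.exp (-Real.log W) ≤ (w : ℝ)⁻¹ := by
    rw [Real.exp_neg, Real.exp_log (by linarith)]
    exact inv_anti₀ hw0 hwW
  -- multiply
  have hprod : Real.exp (-(u * Real.log S₀⁻¹ + u * Real.log u + J * Real.log (4 * Real.log W) +
      J * Real.log J + Real.log W)) ≤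
      S ^ k * ((#(Nat.primesLE w) : ℝ) / w) ^ J / (w * J.factorial * k.factorial) := by
    have : Real.exp (-(u * Real.log S₀⁻¹ + u * Real.log u + J * Real.log (4 * Real.log W) +
        J * Real.log J + Real.log W)) =
        Real.exp (-(u * Real.log S₀⁻¹)) * Real.exp (-(J * Real.log (4 * Real.log W))) *
          (Real.exp (-Real.log W) * Real.exp (-(J * Real.log J)) * Real.exp (-(u * Real.log u))) := by
      simp only [← Real.exp_add]; ring_nf
    rw [this, div_eq_mul_inv, mul_inv, mul_inv]
    refine mul_le_mul (mul_le_mul hE1 hE2 (by positivity) (by positivity)) ?_ (by positivity)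
      (by positivity)
    exact mul_le_mul (mul_le_mul hE5 hE3 (by positivity) (by positivity)) hE4 (by positivity)
      (by positivity)
  calc (x : ℝ) * Real.exp (-(u * Real.log S₀⁻¹ + u * Real.log u + J * Real.log (4 * Real.log W) +
        J * Real.log J + Real.log W))
      ≤ (x : ℝ) * (S ^ k * ((#(Nat.primesLE w) : ℝ) / w) ^ J / (w * J.factorial * k.factorial)) :=
        mul_le_mul_of_nonneg_left hprod (Nat.cast_nonneg _)
    _ = (x : ℝ) * S ^ k * ((#(Nat.primesLE w) : ℝ) / w) ^ J / (w * J.factorial * k.factorial) := by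
        ring
    _ ≤ #(factoredUpTo (Nat.primesLE yN) x) := hmain


/-! ### The `L[1/2]` lower bound for smooth numbers -/

/-- The exponent inequality behind `x < V^k (W/2)^(J+1)` for the parameter choice
`V = y^{1-1/lu}`, `W = y^{1/√lu}`, `k > u - 1`, `J + 1 ≥ 2(u/lu + 1)√lu`:
`log x < k (1 - 1/lu) log y + (J+1) (log y/√lu - log 2)`. [folklore] -/
theorem LHalf.log_lt_of_params {u lx b lu k J₁ : ℝ} (hlu : 4 ≤ lu) (hb : 0 < b)
    (huL : u * b = lx) (hu1 : 1 ≤ u) (hk : u - 1 < k)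
    (hJ₁ : 2 * (u / lu + 1) * Real.sqrt lu ≤ J₁) (hlog16 : Real.log 16 ≤ b / Real.sqrt lu) :
    lx < k * ((1 - lu⁻¹) * b) + J₁ * (b / Real.sqrt lu - Real.log 2) := by
  have hlu0 : 0 < lu := by linarith
  have hsq0 : 0 < Real.sqrt lu := Real.sqrt_pos.2 hlu0
  have hδ1 : 0 < 1 - lu⁻¹ := by
    have : lu⁻¹ ≤ 1 / 4 := by rw [inv_le_comm₀ hlu0 (by norm_num)]; norm_num; linarith
    linarith
  have h1 : (u - 1) * ((1 - lu⁻¹) * b) < k * ((1 - lu⁻¹) * b) :=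
    mul_lt_mul_of_pos_right hk (mul_pos hδ1 hb)
  have hbs : 0 < b / Real.sqrt lu := by positivity
  have hlog2 : Real.log 2 ≤ (b / Real.sqrt lu) / 2 := by
    have : Real.log 16 = 4 * Real.log 2 := by
      rw [show (16 : ℝ) = 2 ^ 4 by norm_num, Real.log_pow]; push_cast; ring
    linarith
  have hpos : 0 ≤ b / Real.sqrt lu - Real.log 2 := by linarith [Real.log_two_gt_d9]
  have hJ₁0 : 0 ≤ J₁ := le_trans (by positivity) hJ₁
  have h2 : 2 * (u / lu + 1) * Real.sqrt lu * ((b / Real.sqrt lu) / 2) ≤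
      J₁ * (b / Real.sqrt lu - Real.log 2) :=
    mul_le_mul hJ₁ (by linarith) (by positivity) hJ₁0
  have e1 : Real.sqrt lu * (b / Real.sqrt lu) = b := by field_simp
  have h3 : 2 * (u / lu + 1) * Real.sqrt lu * ((b / Real.sqrt lu) / 2) = lu⁻¹ * lx + b := by
    calc 2 * (u / lu + 1) * Real.sqrt lu * ((b / Real.sqrt lu) / 2)
        = (u / lu + 1) * (Real.sqrt lu * (b / Real.sqrt lu)) := by ring
      _ = (u / lu + 1) * b := by rw [e1]
      _ = lu⁻¹ * lx + b := by rw [← huL]; ring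
  have h4 : (u - 1) * ((1 - lu⁻¹) * b) = lx - lu⁻¹ * lx - (1 - lu⁻¹) * b := by
    rw [← huL]; ring
  have h5 : 0 ≤ lu⁻¹ * b := by positivity
  linarith

/-- Mertens' window bound in the form needed: with `δ = 1/lu ≤ 1/4` and `16 lu ≤ b = log y`,
`log b - log ((1-δ) b) - 6/((1-δ) b) ≥ δ/2 = 1/(2 lu)`. [folklore] -/
theorem LHalf.inv_two_mul_le {b lu : ℝ} (hlu : 4 ≤ lu) (hb : 0 < b) (ho3 : 16 * lu ≤ b) :
    (2 * lu)⁻¹ ≤ Real.log b - Real.log ((1 - lu⁻¹) * b) - 6 / ((1 - lu⁻¹) * b) := by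
  have hlu0 : 0 < lu := by linarith
  have hδle : lu⁻¹ ≤ 1 / 4 := by rw [inv_le_comm₀ hlu0 (by norm_num)]; norm_num; linarith
  have hδ0 : 0 < lu⁻¹ := by positivity
  have hδ1 : 0 < 1 - lu⁻¹ := by linarith
  rw [Real.log_mul hδ1.ne' hb.ne']
  have hlog1 : Real.log (1 - lu⁻¹) ≤ -lu⁻¹ := by
    have := Real.log_le_sub_one_of_pos hδ1; linarith
  have h6 : 6 / ((1 - lu⁻¹) * b) ≤ 8 / b := by
    rw [div_le_div_iff₀ (by positivity) hb]; nlinarith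
  have h8 : 8 / b ≤ lu⁻¹ / 2 := by
    rw [div_le_iff₀ hb, show lu⁻¹ / 2 * b = b / (2 * lu) by ring, le_div_iff₀ (by positivity)]
    linarith
  have h9 : (2 * lu)⁻¹ = lu⁻¹ / 2 := by rw [mul_inv]; ring
  linarith

/-- **Smooth numbers in the `L[1/2]` range (Canfield–Erdős–Pomerance; Lenstra–Pomerance Thm 6.1
for the set of all primes).** For every `β > 0` and `ε > 0`, for all sufficiently large `x` and
every `y ≥ L_x[1/2, β] = exp (β √(log x · log log x))`, the number `ψ(x, y)` of integers
`1 ≤ n ≤ x` all of whose prime factors are `≤ y` satisfies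
`ψ(x, y) ≥ x · exp (-(1/(2β) + ε) √(log x · log log x)) = x · L_x[1/2, -1/(2β) - ε]`;
with `u = log x / log y = (1/β) √(log x / log log x)` this is `ψ(x, y) ≥ x · u^{-u(1+o(1))}`, the
lower-bound half of `ψ(x, y) = x u^{-u(1+o(1))}` in the range of all `L[1/2]` analyses. From
`card_factoredUpTo_primesLE_ge_exp` with `k = ⌊u⌋`, `V = y^{1-1/log u}`, `W = y^{(log u)^{-1/2}}`,
`J = ⌈2(u/log u + 1)√(log u)⌉`, Mertens over `(V, y]` (`S ≥ 1/(2 log u)`) and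
`LHalf.eventually_bookkeeping`. See `card_smoothNumbersUpTo_ge_LHalf` for Mathlib's
`Nat.smoothNumbersUpTo`. [cite: LenstraPomerance1992, §6 Thm 6.1] -/
theorem card_factoredUpTo_primesLE_ge_LHalf {β ε : ℝ} (hβ : 0 < β) (hε : 0 < ε) :
    ∀ᶠ x : ℕ in atTop, ∀ y : ℕ,
      Real.exp (β * Real.sqrt (Real.log x * Real.log (Real.log x))) ≤ y →
        (x : ℝ) * Real.exp (-(1 / (2 * β) + ε) * Real.sqrt (Real.log x * Real.log (Real.log x)))
          ≤ #(factoredUpTo (Nat.primesLE y) x) := by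
  obtain ⟨s₀, hs₀1, H⟩ := LHalf.eventually_bookkeeping hβ hε
  have hll : Tendsto (fun x : ℕ => Real.log (Real.log (x : ℝ))) atTop atTop :=
    Real.tendsto_log_atTop.comp (Real.tendsto_log_atTop.comp tendsto_natCast_atTop_atTop)
  filter_upwards [hll.eventually_ge_atTop s₀] with x hxs y hy
  -- `s = log log x ≥ s₀ ≥ 1`, `lx = log x = e^s`, `x = e^{lx}`, `L = e^{s/2} √s`
  set lx : ℝ := Real.log (x : ℝ) with hlx_def
  set s : ℝ := Real.log lx with hs_def
  set L : ℝ := Real.sqrt (lx * s) with hL_def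
  have hs1 : 1 ≤ s := hs₀1.trans hxs
  have hs0 : 0 < s := by linarith
  have hlx_pos : 0 < lx := by
    rcases (Real.log_natCast_nonneg x).lt_or_eq with h | h
    · exact h
    · have h' : lx = 0 := by rw [hlx_def]; exact h.symm
      have : s = 0 := by rw [hs_def, h', Real.log_zero]
      linarith
  have hlx_exp : lx = Real.exp s := by rw [hs_def, Real.exp_log hlx_pos]
  have hX1 : (1 : ℝ) < x := (Real.log_pos_iff (Nat.cast_nonneg x)).1 hlx_pos
  have hX_exp : (x : ℝ) = Real.exp lx := by rw [hlx_def, Real.exp_log (by linarith)]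
  have hL_eq : L = Real.exp (s / 2) * Real.sqrt s := by
    rw [hL_def, hlx_exp, Real.sqrt_mul (Real.exp_pos _).le, Real.exp_half]
  have hL0 : 0 < L := by rw [hL_eq]; positivity
  have hLsq : L * L = lx * s := by rw [hL_def]; exact Real.mul_self_sqrt (by positivity)
  -- `u = log x / log y`, `lu = log u`
  set u : ℝ := L / (β * s) with hu_def
  set lu : ℝ := s / 2 - Real.log s / 2 - Real.log β with hlu_def
  obtain ⟨hlu4, ho2, ho3, hexpo⟩ := H s hxs lu L u rfl hL_eq rfl
  have hu_log : Real.log u = lu := by rw [hu_def, hL_eq]; exact LHalf.log_u_eq hβ hs0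
  have hu0 : 0 < u := by positivity
  have hu1 : 1 ≤ u := by
    rw [← Real.exp_log hu0, hu_log]; exact Real.one_le_exp (by linarith)
  have huL : u * (β * L) = lx := by
    rw [hu_def]
    field_simp
    linear_combination hLsq
  have hlu0 : 0 < lu := by linarith
  have hsq0 : 0 < Real.sqrt lu := Real.sqrt_pos.2 hlu0
  have hsq2 : 2 ≤ Real.sqrt lu := by
    rw [show (2 : ℝ) = Real.sqrt 4 by
      rw [show (4 : ℝ) = 2 ^ 2 by norm_num, Real.sqrt_sq (by norm_num)]]
    exact Real.sqrt_le_sqrt hlu4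
  have hβL : 0 < β * L := by positivity
  -- the parameters of the combinatorial theorem
  set Y : ℝ := Real.exp (β * L) with hY_def
  set V : ℝ := Real.exp ((1 - lu⁻¹) * (β * L)) with hV_def
  set W : ℝ := Real.exp (β * L / Real.sqrt lu) with hW_def
  set k : ℕ := ⌊u⌋₊ with hk_def
  set Jr : ℝ := 2 * (u / lu + 1) * Real.sqrt lu with hJr_def
  set J : ℕ := ⌈Jr⌉₊ with hJ_def
  have hδle : lu⁻¹ ≤ 1 / 4 := by rw [inv_le_comm₀ hlu0 (by norm_num)]; norm_num; linarith
  have hδ0 : 0 < lu⁻¹ := by positivity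
  have hθ : β * L / Real.sqrt lu ≤ (β * L) / 2 := div_le_div_of_nonneg_left hβL.le two_pos hsq2
  have hlogW : Real.log W = β * L / Real.sqrt lu := Real.log_exp _
  have hlog16 : Real.log 16 ≤ β * L / Real.sqrt lu := by rwa [le_div_iff₀ hsq0, mul_comm]
  -- hypotheses of `card_factoredUpTo_primesLE_ge_exp`
  have hW : 16 ≤ W := by
    have : Real.exp (Real.log 16) ≤ W := Real.exp_le_exp.2 hlog16
    rwa [Real.exp_log (by norm_num)] at this
  have hWV : W ≤ V := by
    refine Real.exp_le_exp.2 (hθ.trans ?_)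
    nlinarith
  have hVY : V ≤ Y := Real.exp_le_exp.2 (by nlinarith)
  have hku : (k : ℝ) ≤ u := Nat.floor_le hu0.le
  have hYk : Y ^ k ≤ (x : ℝ) := by
    rw [hY_def, ← Real.exp_nat_mul, hX_exp, Real.exp_le_exp, ← huL]
    exact mul_le_mul_of_nonneg_right hku hβL.le
  have hJr0 : 0 ≤ Jr := by positivity
  have hJle : (J : ℝ) ≤ Jr + 1 := (Nat.ceil_lt_add_one hJr0).le
  have hJ : (x : ℝ) < V ^ k * (W / 2) ^ (J + 1) := by
    have hW2 : W / 2 = Real.exp (β * L / Real.sqrt lu - Real.log 2) := by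
      rw [Real.exp_sub, Real.exp_log two_pos]
    rw [hW2, hV_def, ← Real.exp_nat_mul, ← Real.exp_nat_mul, ← Real.exp_add, hX_exp,
      Real.exp_lt_exp]
    have hk : u - 1 < (k : ℝ) := by
      have := Nat.lt_floor_add_one u
      rw [← hk_def] at this
      linarith
    have hJ₁ : 2 * (u / lu + 1) * Real.sqrt lu ≤ ((J + 1 : ℕ) : ℝ) := by
      push_cast
      linarith [Nat.le_ceil Jr]
    exact LHalf.log_lt_of_params hlu4 hβL huL hu1 hk hJ₁ hlog16
  have hS₀ : 0 < (2 * lu)⁻¹ := by positivity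
  have hS₀1 : (2 * lu)⁻¹ ≤ 1 := by
    rw [inv_le_comm₀ (by positivity) one_pos, inv_one]
    linarith
  -- Mertens over the window `(V, Y]`
  have hS : (2 * lu)⁻¹ ≤ ∑ p ∈ (Ioc ⌊V⌋₊ ⌊Y⌋₊).filter Nat.Prime, (p : ℝ)⁻¹ := by
    have hV2 : 2 ≤ V := by linarith
    have hM := Literature.NumberTheory.LFunctions.MertensBound.loglog_sub_loglog_le_sum_inv_prime hV2 hVY
    simp only [one_div] at hM
    refine le_trans ?_ hM
    rw [hY_def, hV_def, Real.log_exp, Real.log_exp]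
    exact LHalf.inv_two_mul_le hlu4 hβL ho3
  -- the explicit theorem, and the exponent comparison
  have key := card_factoredUpTo_primesLE_ge_exp hW hWV hVY hYk hJ hu1 hku hS₀ hS₀1 hS
  have hE' : u * Real.log (2 * lu)⁻¹⁻¹ + u * Real.log u + J * Real.log (4 * Real.log W) +
      J * Real.log J + Real.log W ≤ (1 / (2 * β) + ε) * L := by
    rw [inv_inv, hu_log, hlogW]
    exact hexpo J (Nat.cast_nonneg J) hJle
  -- monotonicity in `y`
  have hyY : ⌊Y⌋₊ ≤ y := Nat.floor_le_of_le hy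
  have hmono : #(factoredUpTo (Nat.primesLE ⌊Y⌋₊) x) ≤ #(factoredUpTo (Nat.primesLE y) x) :=
    card_le_card (factoredUpTo_mono (fun p hp => Nat.mem_primesLE.2
      ⟨(Nat.le_of_mem_primesLE hp).trans hyY, Nat.prime_of_mem_primesLE hp⟩) x)
  calc (x : ℝ) * Real.exp (-(1 / (2 * β) + ε) * Real.sqrt (Real.log x * Real.log (Real.log x)))
      ≤ (x : ℝ) * Real.exp (-(u * Real.log (2 * lu)⁻¹⁻¹ + u * Real.log u +
          J * Real.log (4 * Real.log W) + J * Real.log J + Real.log W)) := by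
        refine mul_le_mul_of_nonneg_left (Real.exp_le_exp.2 ?_) (Nat.cast_nonneg x)
        rw [neg_mul]
        exact neg_le_neg hE'
    _ ≤ #(factoredUpTo (Nat.primesLE ⌊Y⌋₊) x) := key
    _ ≤ #(factoredUpTo (Nat.primesLE y) x) := by exact_mod_cast hmono

/-! ### In terms of Mathlib's `Nat.smoothNumbersUpTo` -/

/-- `ψ(x, y)` in the two vocabularies: `factoredUpTo (primes ≤ y) x = Nat.smoothNumbersUpTo x (y+1)`
(Mathlib's `y+1`-smooth numbers `≤ x`, i.e. all prime factors `< y + 1`). [folklore] -/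
theorem factoredUpTo_primesLE_eq_smoothNumbersUpTo (x y : ℕ) :
    factoredUpTo (Nat.primesLE y) x = Nat.smoothNumbersUpTo x (y + 1) := by
  ext n
  rw [mem_factoredUpTo, Nat.mem_smoothNumbersUpTo, Nat.smoothNumbers_eq_factoredNumbers_primesBelow]
  rfl

/-- `card_factoredUpTo_primesLE_ge_LHalf` for Mathlib's smooth numbers: for `β, ε > 0`,
eventually in `x`, for all `y ≥ exp (β √(log x log log x))`,
`x · exp (-(1/(2β) + ε) √(log x log log x)) ≤ #(Nat.smoothNumbersUpTo x (y + 1))`.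
[cite: LenstraPomerance1992, §6 Thm 6.1] -/
theorem card_smoothNumbersUpTo_ge_LHalf {β ε : ℝ} (hβ : 0 < β) (hε : 0 < ε) :
    ∀ᶠ x : ℕ in atTop, ∀ y : ℕ,
      Real.exp (β * Real.sqrt (Real.log x * Real.log (Real.log x))) ≤ y →
        (x : ℝ) * Real.exp (-(1 / (2 * β) + ε) * Real.sqrt (Real.log x * Real.log (Real.log x)))
          ≤ #(Nat.smoothNumbersUpTo x (y + 1)) := by
  filter_upwards [card_factoredUpTo_primesLE_ge_LHalf hβ hε] with x hx y hy
  rw [← factoredUpTo_primesLE_eq_smoothNumbersUpTo]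
  exact hx y hy

end Literature.NumberTheory.Sieve
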